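import Summits.BirchSwinnertonDyer.BirchSwinnertonDyer.Theorems.Rank2ObservatoryRank3Row0ByName
import Literature.NumberTheory.EllipticCurves.Curve5077aAnalyticRankLeThree
import HarnessLib

/-!
# BirchSwinnertonDyer — rank ≥ 2 observatory: rank-3 census, ROW 0 (`5077a1`) — weak BSD `ord_{s=1} L(E,s) = rank_ℤ E(ℚ)` by name, numerics-free, modulo Modularity and Gross–Zagier–Kolyvagin

HONEST FRAMING: per-curve certified theorems and census instruments; no claim on BSD in rank ≥ 2.
ONE curve, and a statement known in print since 1986 (Buhler–Gross–Zagier 1985 + Gross–Zagier 1986 +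
Kolyvagin 1990 + Cremona's 2-descent): nothing general about BSD is claimed or follows.

Written by cert-2 gen 51 (2026-08-31), filed by cert-2 gen 52.

The last JOIN for row `0`, pure glue BY NAME (no definitions, no data, no numerics): the landed
`Rank2ObservatoryRank3Row0ByName` gives `(rank3Table[0]).curve = Curve5077a.E` (`curve_row0_eq`, `rfl`),
`rank_ℤ = 3` hypothesis-free (`curve5077a_mordellWeilRank_eq_three`) and «weak BSD ← `L‴(E,1) ≠ 0`»
(`curve5077a_analyticRank_eq_rank_of_iteratedDeriv_three_ne_zero`); the Literature module
`Curve5077aAnalyticRankLeThree` gives `L‴(E,1) ≠ 0` / `ord = 3` with NO numerical hypothesis (kernel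
certificate `bgzSum_pos` under the Modularity Theorem; lower bound under Gross–Zagier–Kolyvagin).
Conclusion: **for row `0` of the census, `ord_{s=1} L(E,s) = rank_ℤ E(ℚ)` (`= 3`) is a kernel theorem
modulo exactly the two named published theorems Modularity and Gross–Zagier–Kolyvagin** — no engine-side
ball, no `hKD`/`hR`, no `hup`; BSD's prediction for the row (`iteratedDeriv_three_ne_zero_row0_of_bsd`) is
DISCHARGED. For the other 9 374 rows of N9375 the analytic upper bound remains the engine-side certified ball.

References: J. P. Buhler, B. H. Gross, D. B. Zagier, Math. Comp. 44 (1985) 473–481, §4 (11), (14);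
B. H. Gross, D. B. Zagier, Invent. Math. 84 (1986) 225–320, (8.2)–(8.3); H. Darmon, *Rational Points on
Modular Elliptic Curves* (2004), Thm. 3.22; J. E. Cremona, *Algorithms for Modular Elliptic Curves* (2nd ed.
1997), §3.5–§3.6 and the electronic tables `ecdata` (5077a1); A. Wiles, Clay problem description (2000), p. 2.
-/

-- single-conjunct summit: `Summit.BirchSwinnertonDyer.BirchSwinnertonDyer.…` repeats the name by design
set_option linter.dupNamespace false

namespace Summit.BirchSwinnertonDyer.BirchSwinnertonDyer.Rank2Observatory

open Literature Literature.NumberTheory.EllipticCurves Literature.NumberTheory.EllipticCurves.ModularForms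
open WeierstrassCurve

/-- **Weak BSD for `5077a`: `ord_{s=1} L(E,s) = rank_ℤ E(ℚ)`**, both sides `= 3`, as a kernel theorem
modulo exactly two named published theorems — Modularity (`hmod`) and Gross–Zagier–Kolyvagin (`hGZK`) —
with NO numerical or engine-side hypothesis. [cite: BuhlerGrossZagier1985, §4 (11), (14)]
[cite: GrossZagier1986, (8.2)–(8.3)] [cite: CremonaAlgorithms1997, Tables, §3.5, §3.6] -/
theorem curve5077a_analyticRank_eq_mordellWeilRank (hmod : exists_isNewformOf)
    (hGZK : rank_eq_analyticRank_of_analyticRank_le_one) :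
    Curve5077a.E.analyticRank = Curve5077a.E.mordellWeilRank :=
  curve5077a_analyticRank_eq_rank_of_iteratedDeriv_three_ne_zero hmod hGZK
    (Curve5077a.iteratedDeriv_three_entireLFunction_E_ne_zero hmod hGZK)

/-- **Weak BSD for ROW `0` of the rank-3 census** (`5077a1`), modulo Modularity + Gross–Zagier–Kolyvagin,
engine-free and numerics-free. [cite: BuhlerGrossZagier1985, §4 (14)] [cite: GrossZagier1986, (8.2)–(8.3)]
[cite: Wiles2000, p. 2] -/
theorem weakBSD_row0 (hmod : exists_isNewformOf) (hGZK : rank_eq_analyticRank_of_analyticRank_le_one) :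
    (rank3Table[0]'(by rw [rank3Table_length]; decide)).curve.analyticRank =
      (rank3Table[0]'(by rw [rank3Table_length]; decide)).curve.mordellWeilRank := by
  rw [curve_row0_eq]; exact curve5077a_analyticRank_eq_mordellWeilRank hmod hGZK

/-- Row `0`: `ord_{s=1} L(E,s) = 3 = rank_ℤ E(ℚ)`. [cite: GrossZagier1986, (8.2)–(8.3)] [cite: BuhlerGrossZagier1985, §4 (14)] -/
theorem analyticRank_row0_eq_three_and_rank_eq_three (hmod : exists_isNewformOf)
    (hGZK : rank_eq_analyticRank_of_analyticRank_le_one) :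
    (rank3Table[0]'(by rw [rank3Table_length]; decide)).curve.analyticRank = 3 ∧
      (rank3Table[0]'(by rw [rank3Table_length]; decide)).curve.mordellWeilRank = 3 := by
  rw [curve_row0_eq]
  exact ⟨Curve5077a.analyticRank_E_eq_three_of_modularity_GZK hmod hGZK, curve5077a_mordellWeilRank_eq_three⟩

/-- Row `0`: the analytic UPPER bound `ord_{s=1} L(E,s) ≤ 3` from Modularity ALONE (no GZK, no numerics).
[cite: BuhlerGrossZagier1985, §4 (14)] -/
theorem analyticRank_row0_le_three (hmod : exists_isNewformOf) :
    (rank3Table[0]'(by rw [rank3Table_length]; decide)).curve.analyticRank ≤ 3 := by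
  rw [curve_row0_eq]; exact Curve5077a.analyticRank_E_le_three_of_modularity hmod

/-- **BSD's prediction for row `0` is DISCHARGED**: `L‴(E,1) ≠ 0` for `5077a1` (Modularity + GZK), the
conclusion of `iteratedDeriv_three_ne_zero_row0_of_bsd` without the hypothesis `BirchSwinnertonDyer`.
[cite: BuhlerGrossZagier1985, §4 (14)] -/
theorem iteratedDeriv_three_ne_zero_row0 (hmod : exists_isNewformOf)
    (hGZK : rank_eq_analyticRank_of_analyticRank_le_one) :
    iteratedDeriv 3 (rank3Table[0]'(by rw [rank3Table_length]; decide)).curve.entireLFunction 1 ≠ 0 := by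
  rw [curve_row0_eq]; exact Curve5077a.iteratedDeriv_three_entireLFunction_E_ne_zero hmod hGZK

/-- Row `0` is not where a failure could sit: `¬ 5 ≤ ord_{s=1} L(E,s)` (Modularity alone); contrast
`curve5077a_five_le_analyticRank_of_ne`. One curve; no general claim. [cite: BuhlerGrossZagier1985, §4 (14)] -/
theorem not_five_le_analyticRank_row0 (hmod : exists_isNewformOf) :
    ¬ 5 ≤ (rank3Table[0]'(by rw [rank3Table_length]; decide)).curve.analyticRank := by
  have h := analyticRank_row0_le_three hmod
  omega

end Summit.BirchSwinnertonDyer.BirchSwinnertonDyer.Rank2Observatory
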